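import Summits.ABC.ABC.Theses.DefiniteXi
import Literature.NumberTheory.EllipticCurves.ModularCurve
import Literature.NumberTheory.EllipticCurves.ModularSymbols

/-!
# Sketch — crux idea `eigengeodesic-supnorm` for FreyDegreeBound (stmt-ABC-2019), ideator 3, round 1

First lemma (analytic step) and the typed avatar statements of the line
"deg φ ≤ ℓ_hyp(γ)² · sup(y|f|)² / (f,f) for γ ∈ Γ₀(N) in the transfer class of the long Néron period".
Nothing here is proved; everything must merely elaborate.
-/

noncomputable section

open scoped MatrixGroups ModularForm
open CongruenceSubgroup UpperHalfPlane
open Literature.NumberTheory.EllipticCurves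
open Literature.NumberTheory.EllipticCurves.ModularForms

namespace Summit.ABC.ABC.Cruxes.FreyDegreeBound.EigengeodesicSupnorm

/-- Hyperbolic length of the closed geodesic of a hyperbolic element `γ` (|tr γ| > 2):
`ℓ(γ) = 2 arcosh(|tr γ|/2)`; for |tr γ| ≤ 2 the value is junk (0 or arcosh of something ≤ 1). -/
def geodesicLength {N : ℕ} (γ : Gamma0 N) : ℝ :=
  2 * Real.arcosh (|(((γ : SL(2, ℤ)) : Matrix (Fin 2) (Fin 2) ℤ).trace : ℝ)| / 2)

/-- FIRST LEMMA (analytic step, provable): the period `{∞, γ∞}_f = 2πi ∫_{τ}^{γτ} f dz` of a weight-2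
cusp form over a HYPERBOLIC `γ ∈ Γ₀(N)` is at most `2π · ℓ(γ) · sup_z (Im z · |f z|)`: integrate
`f dz` along the closed geodesic of `γ` (the axis from `τ₀` to `γτ₀`), `|dz| = y ds_hyp`. -/
def PeriodLeLengthMulSup : Prop :=
  ∀ (N : ℕ) (f : CuspForm (Gamma0 N) 2) (γ : Gamma0 N) (S : ℝ),
    2 < |(((γ : SL(2, ℤ)) : Matrix (Fin 2) (Fin 2) ℤ).trace : ℝ)| →
    (∀ z : ℍ, z.im * ‖f z‖ ≤ S) →
      ‖cuspSymbol f γ‖ ≤ 2 * Real.pi * geodesicLength γ * S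

/-- The DEGREE AVATAR (glue, provable from Zagier `4π²c²(f,f) = deg · covol Λ_E` (tree:
`zagier_degree_formula_holds`), `|λ|² ≥ covol` for the long vector of a reduced basis, and
`PeriodLeLengthMulSup`): if `c · {∞,γ∞}_f = deg · λ` with `λ ∈ Λ_E`, `|λ|² ≥ covol(Λ_E)`
(γ in the transfer class of the long basis period) then `deg ≤ ℓ(γ)² S² / (f,f)`. -/
def DegreeLeLengthSqSupSq : Prop :=
  ∀ (N : ℕ) [NeZero N] (W : WeierstrassCurve ℚ) [W.IsElliptic] (D : ModularParametrizationData W N)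
    (γ : Gamma0 N) (S : ℝ) (lam : ℂ),
    2 < |(((γ : SL(2, ℤ)) : Matrix (Fin 2) (Fin 2) ℤ).trace : ℝ)| →
    (∀ z : ℍ, z.im * ‖D.f z‖ ≤ S) →
    lam ∈ D.L.lattice → ZLattice.covolume D.L.lattice ≤ ‖lam‖ ^ 2 →
    (D.c : ℂ) * cuspSymbol D.f γ = (D.deg : ℂ) * lam →
      (D.deg : ℝ) ≤ geodesicLength γ ^ 2 * S ^ 2 / (peterssonProduct (Gamma0 N) 2 D.f D.f).re

/-- ARITHMETIC HALF of the line — ShortEigengeodesic(κ): some γ ∈ Γ₀(N) in the transfer class of a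
long Néron period of the Frey curve (i.e. `c · {∞,γ∞}_f = deg · λ`, `|λ|² ≥ covol`) has geodesic
length `≤ C · N^κ`, i.e. `log |tr γ| ≲ N^κ`. Needed: κ = 3/2 − θ + ε/2 against a sup-norm exponent θ. -/
def ShortEigengeodesic (κ : ℝ) : Prop :=
  ∃ C : ℝ, ∀ a b : ℤ, IsCoprime a b → a * b * (a + b) ≠ 0 → ∀ (N : ℕ) [NeZero N],
    (freyCurve a b).conductorNorm ℤ = N →
      ∀ D : ModularParametrizationData (freyCurve a b) N,
        (∀ D' : ModularParametrizationData (freyCurve a b) N, D.deg ≤ D'.deg) →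
        ∃ (γ : Gamma0 N) (lam : ℂ), lam ∈ D.L.lattice ∧ ZLattice.covolume D.L.lattice ≤ ‖lam‖ ^ 2 ∧
          (D.c : ℂ) * cuspSymbol D.f γ = (D.deg : ℂ) * lam ∧
          2 < |(((γ : SL(2, ℤ)) : Matrix (Fin 2) (Fin 2) ℤ).trace : ℝ)| ∧
          geodesicLength γ ≤ C * (N : ℝ) ^ κ

/-- ANALYTIC HALF — SupNorm(θ): `sup_z Im z |f(z)|² ≤ C · N^(2θ−1+ε) · (f,f)` for the newform of every
Frey curve (Harcos–Templier 2013: θ = 1/3 for squarefree level; conjecture: θ = 0). -/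
def SupNorm (θ : ℝ) : Prop :=
  ∀ ε : ℝ, 0 < ε → ∃ C : ℝ, ∀ a b : ℤ, IsCoprime a b → a * b * (a + b) ≠ 0 → ∀ (N : ℕ) [NeZero N],
    (freyCurve a b).conductorNorm ℤ = N →
      ∀ D : ModularParametrizationData (freyCurve a b) N, ∀ z : ℍ,
        (z.im * ‖D.f z‖) ^ 2 ≤ C * (N : ℝ) ^ (2 * θ - 1 + ε) * (peterssonProduct (Gamma0 N) 2 D.f D.f).re

/-- Shape of the composition the crux-plan would certify (NOT claimed proved here):
the two halves with θ → 0 give the crux; with Harcos–Templier (θ = 1/3) and κ = 7/6 they give it too. -/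
def LineShape : Prop :=
  DegreeLeLengthSqSupSq → (∀ θ : ℝ, 0 < θ → SupNorm θ ∧ ShortEigengeodesic (3 / 2 - θ)) →
    Summit.ABC.ABC.Theses.DefiniteXi.FreyModularity →
    Summit.ABC.ABC.Theses.DefiniteXi.MinimalBoundGivesTarget →
    Summit.ABC.ABC.Theses.DefiniteXi.FreyDegreeBound

end Summit.ABC.ABC.Cruxes.FreyDegreeBound.EigengeodesicSupnorm
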